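import Mathlib
import Summits.ValiantsHypothesis.ValiantsHypothesis.Theorems.RigidityForcesSymmetryRankRigidMinimalReprLaplaceFiveCertified
import Summits.ValiantsHypothesis.ValiantsHypothesis.Theorems.RigidityForcesSymmetryRankRigidMinimalReprLaplaceHybridWitness2

/-!
# `LaplaceOptimalFive`: decompositions of `P₅` refuted by an interleaved (single-credit) dual certificate
# (crux `RankRigidMinimalRepr`, stmt-ValiantsHypothesis-18034; frontier rung `LaplaceOptimalFive`, stmt-24813)

`certified_no_decomposition2`: the `d = 5` wrapper of the interleaved hybrid witness lemma
`LaplaceTriangular.hybrid_witness2` (`…LaplaceHybridWitness2.lean`), in the same data format as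
`LaplaceFiveSlices.certified_no_decomposition` (`…LaplaceFiveCertified.lean`, the wrapper of `hybrid_witness`).
A purported decomposition of the `5 × 5` permutation pattern into `Ns` slices `α_k(v_{i k}) · W_k(v)` (`W_k` blind to
slot `i k`) and `Np` pair terms `u_t(v_{p t}, v_{q t}) · w_t(v)` (`w_t` blind to the two slots) is impossible as soon as
an INTERLEAVED CERTIFICATE exists:
* an order `ord` of the five slots (position `↦` slot) and a marking `isB` of the BASIS positions;
* for every pair term a kill side: `side t = false` — the 2-slot side, charged at the endpoint `lp t` with the other
  endpoint `e1 t` earlier; `side t = true` — the 3-slot side `{e1 t, e2 t, lp t} = {p t, q t}ᶜ`, charged at `lp t`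
  with `e1 t, e2 t` earlier;
* designations: a basis position `r` may designate ONE term charged at a LATER position whose constraint vector is
  determined before `r` — a slice (`desS r = some k`, no condition) or a pair term (`desP r = some t`: `e1 t`, and for
  the 3-slot side also `e2 t`, come before `r`); distinct designations credit distinct slots;
* the COUNTS: at a general position `j` (slot `ord j`, `m` = number of slices at the slot plus pair terms charged
  there, `cr ∈ {0, 1}` = number of earlier positions designating a term of that slot) `m + j + 1 ≤ 5 + cr`; at a
  basis position `m ≤ cr`.
Every hypothesis on the certificate is decidable from the profile `(i, p, q)` and the certificate — NO condition on the
tensors (in contrast with the bonus `α_k(cb r) ≠ 0` of `certified_no_decomposition`), which is what an all-labelling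
assembly by kernel search needs (degenerate slice vectors need no separate treatment).
Proof: `hybrid_witness2` produces covectors killing every term with non-zero permanent, and
`LaplaceDual.no_decomposition_of_witness` concludes (`w`-side kills through `LaplaceFiveSlices.pairing_compl_three`).

Reach (evidence of this seat, val-width-24813-w1, exhaustive search mirroring these hypotheses literally plus a
brute-force cross-check): among the 107 maximal cheap profiles of `P₅` with three slices, certificates of this shape
exist for 97 (the same 97 as for `certified_no_decomposition`), i.e. for 633 of the 660 sorted labelled
configurations over the three slot patterns `{x,x,x}`, `{x,x,y}`, `{x,y,z}`; the 10 remaining types are listed in the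
seat's evidence note on stmt-24813.  HONEST FRAMING: an exact partial result toward the frontier rung
`LaplaceOptimalFive` (stmt-24813), which stays OPEN; nothing here bears on `VP ≠ VNP`.
-/

set_option autoImplicit false

-- the mandated summit-side namespace repeats a component by design (single-problem summit)
set_option linter.dupNamespace false

namespace Summit.ValiantsHypothesis.ValiantsHypothesis.Theorems.RigidityForcesSymmetryRankRigidMinimalRepr

namespace LaplaceFiveSlices

open Finset

/-- **No decomposition of `P₅` admits an interleaved dual certificate.**  Slices `α_k(v_{i k}) · W_k(v)` (`k < Ns`),
pair terms `u_t(v_{p t}, v_{q t}) · w_t(v)` (`t < Np`); certificate: slot order `ord`, basis marking `isB` of the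
positions, kill sides `side` with charge slots `lp` and earlier slots `e1` (and `e2` for the 3-slot side), designations
`desS` / `desP` of the basis positions (at most one each, toward a later-charged term already determined, distinct
designations crediting distinct slots), and the two counts.  Then the decomposition identity is impossible. -/
theorem certified_no_decomposition2 {Ns Np : ℕ}
    (i : Fin Ns → Fin 5) (α : Fin Ns → Fin 5 → ℂ) (W : Fin Ns → (Fin 5 → Fin 5) → ℂ)
    (hW : ∀ k, ∀ v v' : Fin 5 → Fin 5, (∀ j, j ≠ i k → v j = v' j) → W k v = W k v')
    (p q : Fin Np → Fin 5) (hpq : ∀ t, p t ≠ q t) (u w : Fin Np → (Fin 5 → Fin 5) → ℂ)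
    (hu : ∀ t, ∀ v v' : Fin 5 → Fin 5, v (p t) = v' (p t) → v (q t) = v' (q t) → u t v = u t v')
    (hw : ∀ t, ∀ v v' : Fin 5 → Fin 5, (∀ j, j ≠ p t → j ≠ q t → v j = v' j) → w t v = w t v')
    -- the certificate
    (ord : Equiv.Perm (Fin 5)) (isB : Fin 5 → Bool)
    (side : Fin Np → Bool) (lp e1 e2 : Fin Np → Fin 5)
    (hsideU : ∀ t, side t = false → (lp t = p t ∧ e1 t = q t ∨ lp t = q t ∧ e1 t = p t) ∧
      ord.symm (e1 t) < ord.symm (lp t))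
    (hsideW : ∀ t, side t = true → lp t ≠ p t ∧ lp t ≠ q t ∧ e1 t ≠ p t ∧ e1 t ≠ q t ∧ e2 t ≠ p t ∧ e2 t ≠ q t ∧
      e1 t ≠ e2 t ∧ e1 t ≠ lp t ∧ e2 t ≠ lp t ∧ ord.symm (e1 t) < ord.symm (lp t) ∧ ord.symm (e2 t) < ord.symm (lp t))
    (desS : Fin 5 → Option (Fin Ns)) (desP : Fin 5 → Option (Fin Np))
    (hdesS : ∀ r k, desS r = some k → isB r = true ∧ r < ord.symm (i k))
    (hdesP : ∀ r t, desP r = some t → isB r = true ∧ r < ord.symm (lp t) ∧ ord.symm (e1 t) < r ∧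
      (side t = true → ord.symm (e2 t) < r))
    (hdes0 : ∀ r, desS r = none ∨ desP r = none)
    (hdSS : ∀ r r' k k', desS r = some k → desS r' = some k' → i k = i k' → r = r')
    (hdSP : ∀ r r' k t, desS r = some k → desP r' = some t → i k ≠ lp t)
    (hdPP : ∀ r r' t t', desP r = some t → desP r' = some t' → lp t = lp t' → r = r')
    (hcountG : ∀ j : Fin 5, isB j = false →
      (univ.filter (fun k => i k = ord j)).card + (univ.filter (fun t => lp t = ord j)).card + (j : ℕ) + 1 ≤
        5 + (univ.filter (fun r : Fin 5 => r < j ∧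
          ((∃ k, desS r = some k ∧ i k = ord j) ∨ (∃ t, desP r = some t ∧ lp t = ord j)))).card)
    (hcountB : ∀ j : Fin 5, isB j = true →
      (univ.filter (fun k => i k = ord j)).card + (univ.filter (fun t => lp t = ord j)).card ≤
        (univ.filter (fun r : Fin 5 => r < j ∧
          ((∃ k, desS r = some k ∧ i k = ord j) ∨ (∃ t, desP r = some t ∧ lp t = ord j)))).card) :
    ¬ ∀ v : Fin 5 → Fin 5,
      (if Function.Injective v then (1 : ℂ) else 0) = (∑ k, α k (v (i k)) * W k v) + ∑ t, u t v * w t v := by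
  classical
  intro H
  -- the charged constraints, indexed by `Fin (Ns + Np)` (slices first)
  let c0 : Fin 5 := 0
  let nU : Fin Np → (Fin 5 → Fin 5 → ℂ) → (Fin 5 → ℂ) := fun t φ y =>
    ∑ a, φ (e1 t) a * u t (Function.update (Function.update (fun _ => c0) (e1 t) a) (lp t) y)
  let nW : Fin Np → (Fin 5 → Fin 5 → ℂ) → (Fin 5 → ℂ) := fun t φ z =>
    ∑ xy : Fin 5 × Fin 5, φ (e1 t) xy.1 * φ (e2 t) xy.2 *
      w t (Function.update (Function.update (Function.update (fun _ => c0) (e1 t) xy.1) (e2 t) xy.2) (lp t) z)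
  let l : Fin (Ns + Np) → Fin 5 := Fin.addCases (fun k => i k) (fun t => lp t)
  let Nv : Fin (Ns + Np) → (Fin 5 → Fin 5 → ℂ) → (Fin 5 → ℂ) :=
    Fin.addCases (fun k _ => α k) (fun t φ => if side t then nW t φ else nU t φ)
  have hl1 : ∀ k, l (Fin.castAdd Np k) = i k := fun k => by simp [l]
  have hl2 : ∀ t, l (Fin.natAdd Ns t) = lp t := fun t => by simp [l]
  have hN1 : ∀ k φ, Nv (Fin.castAdd Np k) φ = α k := fun k φ => by simp [Nv]
  have hN2 : ∀ t φ, Nv (Fin.natAdd Ns t) φ = if side t then nW t φ else nU t φ := fun t φ => by simp [Nv]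
  -- locality of a pair constraint: it only sees `e1 t` (and `e2 t` on the 3-slot side)
  have hlocP : ∀ t, ∀ φ φ' : Fin 5 → Fin 5 → ℂ, φ (e1 t) = φ' (e1 t) → (side t = true → φ (e2 t) = φ' (e2 t)) →
      (if side t then nW t φ else nU t φ) = (if side t then nW t φ' else nU t φ') := by
    intro t φ φ' h1 h2
    cases hst : side t
    · simp only [Bool.false_eq_true, if_false, nU]
      rw [h1]
    · simp only [if_true, nW]
      rw [h1, h2 hst]
  have hloc : ∀ s, ∀ φ φ' : Fin 5 → Fin 5 → ℂ, (∀ x, ord.symm x < ord.symm (l s) → φ x = φ' x) →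
      Nv s φ = Nv s φ' := by
    intro s φ φ' hφ
    induction s using Fin.addCases with
    | left k => rw [hN1, hN1]
    | right t =>
      rw [hN2, hN2]
      rw [hl2] at hφ
      refine hlocP t φ φ' ?_ ?_
      · cases hst : side t
        · exact hφ (e1 t) (hsideU t hst).2
        · exact hφ (e1 t) (hsideW t hst).2.2.2.2.2.2.2.2.2.1
      · intro hst
        exact hφ (e2 t) (hsideW t hst).2.2.2.2.2.2.2.2.2.2
  -- the designation map on `Fin (Ns + Np)`
  let des : Fin 5 → Option (Fin (Ns + Np)) := fun r =>
    match desS r with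
    | some k => some (Fin.castAdd Np k)
    | none => (desP r).map (Fin.natAdd Ns)
  have hdes_cases : ∀ r s, des r = some s →
      (∃ k, desS r = some k ∧ s = Fin.castAdd Np k) ∨ (∃ t, desP r = some t ∧ s = Fin.natAdd Ns t) := by
    intro r s hs
    simp only [des] at hs
    cases hS : desS r with
    | some k =>
      rw [hS] at hs
      left; exact ⟨k, rfl, by simpa using hs.symm⟩
    | none =>
      rw [hS] at hs
      simp only [Option.map_eq_some_iff] at hs
      obtain ⟨t, ht, hts⟩ := hs
      right; exact ⟨t, ht, hts.symm⟩
  have hdes_ofS : ∀ r k, desS r = some k → des r = some (Fin.castAdd Np k) := by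
    intro r k hk
    simp only [des, hk]
  have hdes_ofP : ∀ r t, desP r = some t → des r = some (Fin.natAdd Ns t) := by
    intro r t ht
    have hS : desS r = none := by
      rcases hdes0 r with h | h
      · exact h
      · rw [h] at ht; exact absurd ht (by simp)
    simp only [des, hS, ht, Option.map_some]
  -- the credit predicate, in the two languages
  have hcred_iff : ∀ (j r : Fin 5), (∃ s, des r = some s ∧ l s = ord j) ↔
      ((∃ k, desS r = some k ∧ i k = ord j) ∨ (∃ t, desP r = some t ∧ lp t = ord j)) := by
    intro j r
    constructor
    · rintro ⟨s, hs, hls⟩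
      rcases hdes_cases r s hs with ⟨k, hk, rfl⟩ | ⟨t, ht, rfl⟩
      · left; exact ⟨k, hk, by rw [hl1] at hls; exact hls⟩
      · right; exact ⟨t, ht, by rw [hl2] at hls; exact hls⟩
    · rintro (⟨k, hk, hik⟩ | ⟨t, ht, hlt⟩)
      · exact ⟨Fin.castAdd Np k, hdes_ofS r k hk, by rw [hl1]; exact hik⟩
      · exact ⟨Fin.natAdd Ns t, hdes_ofP r t ht, by rw [hl2]; exact hlt⟩
  have hcred_card : ∀ j : Fin 5,
      (univ.filter (fun r : Fin 5 => r < j ∧ ∃ s, des r = some s ∧ l s = ord j)).card =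
      (univ.filter (fun r : Fin 5 => r < j ∧
        ((∃ k, desS r = some k ∧ i k = ord j) ∨ (∃ t, desP r = some t ∧ lp t = ord j)))).card := by
    intro j
    refine congrArg Finset.card (filter_congr fun r _ => ?_)
    rw [hcred_iff j r]
  -- designation hypotheses of `hybrid_witness2`
  have hdes : ∀ r s, des r = some s → isB r = true ∧ r < ord.symm (l s) ∧
      ∀ φ φ' : Fin 5 → Fin 5 → ℂ, (∀ x, ord.symm x < r → φ x = φ' x) → Nv s φ = Nv s φ' := by
    intro r s hs
    rcases hdes_cases r s hs with ⟨k, hk, rfl⟩ | ⟨t, ht, rfl⟩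
    · obtain ⟨hB, hr⟩ := hdesS r k hk
      exact ⟨hB, by rw [hl1]; exact hr, fun φ φ' _ => by rw [hN1, hN1]⟩
    · obtain ⟨hB, hr, h1, h2⟩ := hdesP r t ht
      refine ⟨hB, by rw [hl2]; exact hr, fun φ φ' hφ => ?_⟩
      rw [hN2, hN2]
      exact hlocP t φ φ' (hφ (e1 t) h1) (fun hst => hφ (e2 t) (h2 hst))
  have hdes1 : ∀ r r' s s', des r = some s → des r' = some s' → l s = l s' → r = r' := by
    intro r r' s s' hs hs' hll
    rcases hdes_cases r s hs with ⟨k, hk, rfl⟩ | ⟨t, ht, rfl⟩ <;>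
      rcases hdes_cases r' s' hs' with ⟨k', hk', rfl⟩ | ⟨t', ht', rfl⟩
    · rw [hl1, hl1] at hll; exact hdSS r r' k k' hk hk' hll
    · rw [hl1, hl2] at hll; exact absurd hll (hdSP r r' k t' hk ht')
    · rw [hl2, hl1] at hll; exact absurd hll.symm (hdSP r' r k' t hk' ht)
    · rw [hl2, hl2] at hll; exact hdPP r r' t t' ht ht' hll
  -- the count in terms of `l`
  have hcard : ∀ s0 : Fin 5, (univ.filter (fun s => l s = s0)).card =
      (univ.filter (fun k => i k = s0)).card + (univ.filter (fun t => lp t = s0)).card := by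
    intro s0
    rw [← Finset.card_map (finSumFinEquiv.symm.toEmbedding)]
    have : (univ.filter (fun s => l s = s0)).map finSumFinEquiv.symm.toEmbedding =
        (univ.filter (fun k : Fin Ns => i k = s0)).map Function.Embedding.inl ∪
          (univ.filter (fun t : Fin Np => lp t = s0)).map Function.Embedding.inr := by
      ext x
      simp only [mem_map, mem_filter, mem_univ, true_and, mem_union, Equiv.toEmbedding_apply,
        Function.Embedding.inl_apply, Function.Embedding.inr_apply]
      constructor
      · rintro ⟨s, hs, rfl⟩
        induction s using Fin.addCases with
        | left k => left; exact ⟨k, by rw [hl1] at hs; exact hs, by simp⟩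
        | right t => right; exact ⟨t, by rw [hl2] at hs; exact hs, by simp⟩
      · rintro (⟨k, hk, rfl⟩ | ⟨t, ht, rfl⟩)
        · exact ⟨Fin.castAdd Np k, by rw [hl1]; exact hk, by simp⟩
        · exact ⟨Fin.natAdd Ns t, by rw [hl2]; exact ht, by simp⟩
    rw [this, card_union_of_disjoint, card_map, card_map]
    rw [disjoint_left]
    rintro x hx hx'
    simp only [mem_map, Function.Embedding.inl_apply, Function.Embedding.inr_apply] at hx hx'
    obtain ⟨k, -, rfl⟩ := hx
    obtain ⟨t, -, h⟩ := hx'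
    exact Sum.inr_ne_inl h
  have hcountG' : ∀ j : Fin 5, isB j = false →
      (univ.filter (fun s => l s = ord j)).card + (j : ℕ) + 1 ≤
        5 + (univ.filter (fun r : Fin 5 => r < j ∧ ∃ s, des r = some s ∧ l s = ord j)).card := by
    intro j hj
    rw [hcard, hcred_card]
    exact hcountG j hj
  have hcountB' : ∀ j : Fin 5, isB j = true →
      (univ.filter (fun s => l s = ord j)).card ≤
        (univ.filter (fun r : Fin 5 => r < j ∧ ∃ s, des r = some s ∧ l s = ord j)).card := by
    intro j hj
    rw [hcard, hcred_card]
    exact hcountB j hj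
  obtain ⟨φ, hkill, hper⟩ :=
    LaplaceTriangular.hybrid_witness2 (n := 5) ord isB l Nv hloc des hdes hdes1 hcountG' hcountB'
  -- the decomposition in the data format of `LaplaceOptimal 5`
  let S : Fin (Ns + Np) → Finset (Fin 5) := Fin.addCases (fun k => ({i k} : Finset (Fin 5))) (fun t => {p t, q t})
  let U : Fin (Ns + Np) → (Fin 5 → Fin 5) → ℂ := Fin.addCases (fun k v => α k (v (i k))) (fun t => u t)
  let V : Fin (Ns + Np) → (Fin 5 → Fin 5) → ℂ := Fin.addCases W (fun t => w t)
  have hS1 : ∀ k, S (Fin.castAdd Np k) = {i k} := fun k => by simp [S]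
  have hS2 : ∀ t, S (Fin.natAdd Ns t) = {p t, q t} := fun t => by simp [S]
  have hU1 : ∀ k, U (Fin.castAdd Np k) = fun v => α k (v (i k)) := fun k => by simp [U]
  have hU2 : ∀ t, U (Fin.natAdd Ns t) = u t := fun t => by simp [U]
  have hV1 : ∀ k, V (Fin.castAdd Np k) = W k := fun k => by simp [V]
  have hV2 : ∀ t, V (Fin.natAdd Ns t) = w t := fun t => by simp [V]
  refine LaplaceDual.no_decomposition_of_witness (d := 5) (univ : Finset (Fin (Ns + Np))) S U V ?_ ?_ c0 φ hper
    ?_ ?_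
  · intro s v v' hvv'
    induction s using Fin.addCases with
    | left k =>
      rw [hU1]
      have := hvv' (i k) (by rw [hS1]; simp)
      simp [this]
    | right t =>
      rw [hU2]
      exact hu t v v' (hvv' (p t) (by rw [hS2]; simp)) (hvv' (q t) (by rw [hS2]; simp))
  · intro s v v' hvv'
    induction s using Fin.addCases with
    | left k =>
      rw [hV1]
      exact hW k v v' (fun j hj => hvv' j (by rw [hS1]; simpa using hj))
    | right t =>
      rw [hV2]
      exact hw t v v' (fun j hjp hjq => hvv' j (by rw [hS2]; simp [hjp, hjq]))
  · -- every term is killed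
    intro s _
    induction s using Fin.addCases with
    | left k =>
      left
      rw [hS1, hU1]
      refine LaplaceDual.kill_slice (d := 5) c0 (i k) φ (fun v => α k (v (i k))) ?_
      have := hkill (Fin.castAdd Np k)
      rw [hl1, hN1] at this
      simpa [Function.update_self] using this
    | right t =>
      have hk := hkill (Fin.natAdd Ns t)
      rw [hl2, hN2] at hk
      cases hst : side t
      · -- u-side kill
        left
        rw [hS2, hU2]
        refine LaplaceDual.kill_pair (d := 5) c0 (p t) (q t) (hpq t) φ (u t) ?_
        simp only [hst, Bool.false_eq_true, if_false, nU] at hk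
        rcases (hsideU t hst).1 with ⟨hl, ho⟩ | ⟨hl, ho⟩
        · -- charged at `p t`, other endpoint `q t`
          rw [hl, ho] at hk
          rw [Fintype.sum_prod_type]
          rw [← hk]
          refine sum_congr rfl fun y _ => ?_
          rw [mul_sum]
          refine sum_congr rfl fun a _ => ?_
          rw [Function.update_comm (hpq t).symm]
          ring
        · -- charged at `q t`, other endpoint `p t`
          rw [hl, ho] at hk
          rw [Fintype.sum_prod_type, Finset.sum_comm, ← hk]
          refine sum_congr rfl fun y _ => ?_
          rw [mul_sum]
          exact sum_congr rfl fun a _ => by ring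
      · -- w-side kill
        right
        rw [hS2, hV2]
        obtain ⟨g1, g2, g3, g4, g5, g6, g7, g8, g9, -, -⟩ := hsideW t hst
        rw [pairing_compl_three c0 (p t) (q t) (e1 t) (e2 t) (lp t) (hpq t) g3.symm g5.symm g1.symm g4.symm
          g6.symm g2.symm g7 g8 g9 φ (w t)]
        simp only [hst, if_true, nW] at hk
        -- Σ_{x,y,z} … = Σ_z φ lp z · nW z
        rw [← hk]
        symm
        calc (∑ z, φ (lp t) z * ∑ xy : Fin 5 × Fin 5, φ (e1 t) xy.1 * φ (e2 t) xy.2 *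
                w t (Function.update (Function.update (Function.update (fun _ => c0) (e1 t) xy.1) (e2 t) xy.2)
                  (lp t) z))
            = ∑ z, ∑ xy : Fin 5 × Fin 5, φ (lp t) z * (φ (e1 t) xy.1 * φ (e2 t) xy.2 *
                w t (Function.update (Function.update (Function.update (fun _ => c0) (e1 t) xy.1) (e2 t) xy.2)
                  (lp t) z)) := by simp_rw [Finset.mul_sum]
          _ = ∑ zxy : Fin 5 × (Fin 5 × Fin 5), φ (lp t) zxy.1 * (φ (e1 t) zxy.2.1 * φ (e2 t) zxy.2.2 *
                w t (Function.update (Function.update (Function.update (fun _ => c0) (e1 t) zxy.2.1) (e2 t) zxy.2.2)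
                  (lp t) zxy.1)) := by rw [Fintype.sum_prod_type]
          _ = _ := by
            refine Fintype.sum_equiv ((Equiv.prodComm _ _).trans (Equiv.prodAssoc _ _ _)) _ _ (fun zxy => ?_)
            obtain ⟨z, x, y⟩ := zxy
            simp only [Equiv.trans_apply, Equiv.prodComm_apply, Prod.swap_prod_mk, Equiv.prodAssoc_apply]
            ring
  · -- the purported identity
    intro v
    rw [Fin.sum_univ_add]
    simp only [hU1, hU2, hV1, hV2]
    exact (H v).symm

end LaplaceFiveSlices

end Summit.ValiantsHypothesis.ValiantsHypothesis.Theorems.RigidityForcesSymmetryRankRigidMinimalRepr
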